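import Literature.Geometry.Kaehler.ComplexTorusSpecialLinearGroupConnected
import Literature.Geometry.Kaehler.ComplexTorusSymplecticGroupGramConnected
import Literature.Geometry.Kaehler.ComplexTorusHodgeGroupProductProjections
import HarnessLib

/-!
# The Siegel Levi subgroup `Sp_{2l} ∩ (GL_l × GL_l) = {diag(g, ᵗg⁻¹)} ≅ GL_l` is connected, and so is the
# unitary group of a split skew-Hermitian pair `V₁ ⊕ V₂` (Milne 1999, Remark 2.2: `U(φ)_Ω ≅ GL(V₁)`)

Layer `Literature/Geometry/Kaehler`, namespace `Literature.Geometry.Kaehler.ComplexTorus`; lane `lit-hodgefound`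
(Track 2 foundations library), skeleton seat skel-4 (generation 35), row A4-94 (the `GL`-blocks of Milne's `S(X)` for
type IV). Sequel BY NAME of `ComplexTorusSpecialLinearGroupConnected` (`slGenerators`, `closure_iUnion_slGenerators_eq_top`,
`transvectionSL`, `rankOneTorusHom`, `torusVec`), `ComplexTorusSymplecticGroupConnected` (`symplecticGroupC`,
`isZariskiClosed_symplecticGroupC`), `ComplexTorusSymplecticGroupGramConnected` (`conjGLC`, `transpose_mul_mul_eq_iff_conj`,
`isPrime_vanishingIdealC_map_conjGLC`, `IsZariskiClosed.map_conjGLC`), `ComplexTorusHodgeGroupProductProjections`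
(`isZariskiClosed_centralizer`) and `ComplexTorusHodgeGroupIrreducible` (`IsLaurentGenerator`,
`isPrime_vanishingIdealC_closure_iUnion`).

## Sources, verbatim

* [Milne1999LefschetzClasses] J. S. Milne, *Lefschetz classes on abelian varieties*, Duke Math. J. 96 (1999),
  §2 Remark 2.2 (p. 647–648): «Let `k` be a field, and let `k'` be an étale `k`-algebra of degree 2 […] Let `φ` be a
  nondegenerate skew-Hermitian form on a `k'`-vector space `V` relative to the nontrivial involution of `k'` fixing `k`.
  […] Write `V ⊗_k Ω = V₁ ⊕ V₂` […] Then `φ|V₁ × V₁ = 0 = φ|V₂ × V₂`, and there is a nondegenerate `Ω`-bilinear form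
  `φ₁ : V₁ × V₂ → Ω` such that `φ((x₁, x₂), (y₁, y₂)) = (φ₁(x₁, y₂), −φ₁(x₂, y₁))` […] Therefore, the map
  `α ↦ α|V₁ : U(φ)_Ω → GL(V₁)` is an isomorphism, and the representation of `U(φ)_Ω` on `V ⊗_k Ω` becomes the direct
  sum of the representation of `GL(V₁)` on `V₁` (standard representation) and the representation of `GL(V₁)` on `V₂`
  (contragredient of the standard representation).»; «Simple abelian variety of type IV» (p. 651):
  «`S(A)_{/k^al} = ∏ S_σ` where `S_σ ≈ Aut(V₁) ≈ GL(k^al)`»; Summary table (p. 652): «IV ∣ GL ∣ Semisimple: No ∣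
  Connected: Yes».
* [Springer1998] T. A. Springer, *Linear Algebraic Groups*, 2nd ed. (1998), Exercise 2.2.2 (1): «`G_m`, `GL_n`, `D_n`,
  `T_n`, `U_n` […] are connected»; Prop. 2.2.1; Cor. 2.2.7 (i) (groups generated by irreducible families through `e`
  are connected).
* [MalleTesterman2011] G. Malle, D. Testerman, *Linear Algebraic Groups and Finite Groups of Lie Type* (2011),
  Prop. 1.16 and Example 1.17 (1) («`SL_n` is connected», root groups and tori).

## What is proved (two definitions with bodies — the central torus `leviScalar` and the subgroup `siegelLevi`; no
## named fact, net debt 0)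

* §1 `siegelLevi l = Sp_{2l}(ℂ) ⊓ C_{SL}(diag(2·1, ½·1)) ≤ SL_{l ⊕ l}(ℂ)`; membership: `N = diag(g, g')` with
  `ᵗg g' = 1` (`mem_siegelLevi_iff`); the embedding `siegelEmb : SL_l(ℂ) →* SL_{2l}(ℂ)`, `g ↦ diag(g, ᵗg⁻¹)`, and the
  central torus `leviScalar u = diag(u·1, u⁻¹·1)`; every element is `siegelEmb(s) · leviScalar(μ)`, `μ^l = det g`.
* §2 `siegelLevi l` is the closure of the Laurent generators `siegelEmb(U_{ij})`, `siegelEmb(T_{ij})`, `leviScalar(ℂ^×)`, hence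
  Zariski-closed with prime vanishing ideal (`isPrime_vanishingIdealC_siegelLevi`: «`GL` … Connected: Yes»).
* §3 Milne's Remark 2.2 in coordinates: for an alternating invertible `H` on `l ⊕ l` with `H|V₁ × V₁ = 0 = H|V₂ × V₂`
  the group `{N ∈ SL_{2l}(ℂ) | ᵗN H N = H, N(V₁) ⊆ V₁, N(V₂) ⊆ V₂}` is a `GL`-conjugate of `siegelLevi l`, hence
  Zariski-closed and irreducible (`exists_subgroup_unitaryPair`).
-/

noncomputable section

open Matrix

namespace Literature.Geometry.Kaehler

namespace ComplexTorus

/-! ## §1 The Siegel Levi subgroup `{diag(g, ᵗg⁻¹)}` of `Sp_{2l}(ℂ)` -/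

section Levi

variable (l : Type*) [Fintype l] [DecidableEq l]

/-- `det diag(u·1, u⁻¹·1) = 1`. [folklore] -/
private theorem det_fromBlocks_smul_one_levi {u : ℂ} (hu : u ≠ 0) :
    (fromBlocks (u • (1 : Matrix l l ℂ)) 0 0 (u⁻¹ • (1 : Matrix l l ℂ))).det = 1 := by
  rw [det_fromBlocks_zero₂₁, det_smul, det_smul, det_one, mul_one, mul_one, ← mul_pow, mul_inv_cancel₀ hu, one_pow]

/-- **The central torus `Z(u) = diag(u·1_l, u⁻¹·1_l)` of the Siegel Levi** (the centre `G_m` of `GL_l ↪ Sp_{2l}`).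
[cite: Milne1999LefschetzClasses, §2 Remark 2.2 («`U(φ)_Ω → GL(V₁)` is an isomorphism»)] [cite: Springer1998, Exercise 2.2.2 (1) («`G_m`»)] -/
def leviScalar : ℂˣ →* SpecialLinearGroup (l ⊕ l) ℂ where
  toFun u := ⟨fromBlocks ((u : ℂ) • 1) 0 0 ((u : ℂ)⁻¹ • 1), det_fromBlocks_smul_one_levi l u.ne_zero⟩
  map_one' := Subtype.ext (by
    change fromBlocks (((1 : ℂˣ) : ℂ) • (1 : Matrix l l ℂ)) 0 0 (((1 : ℂˣ) : ℂ)⁻¹ • 1) = 1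
    rw [Units.val_one, inv_one, one_smul, fromBlocks_one])
  map_mul' u v := Subtype.ext (by
    change fromBlocks (((u * v : ℂˣ) : ℂ) • (1 : Matrix l l ℂ)) 0 0 (((u * v : ℂˣ) : ℂ)⁻¹ • 1) =
      fromBlocks ((u : ℂ) • (1 : Matrix l l ℂ)) 0 0 ((u : ℂ)⁻¹ • 1) *
        fromBlocks ((v : ℂ) • (1 : Matrix l l ℂ)) 0 0 ((v : ℂ)⁻¹ • 1)
    rw [fromBlocks_multiply, Units.val_mul, mul_inv]
    simp only [Matrix.mul_zero, Matrix.zero_mul, add_zero, zero_add, Matrix.smul_mul, Matrix.mul_smul,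
      Matrix.one_mul, smul_smul, smul_zero, mul_comm (v : ℂ) (u : ℂ), mul_comm (v : ℂ)⁻¹ (u : ℂ)⁻¹])

/-- The matrix of `leviScalar u`. [cite: Milne1999LefschetzClasses, §2 Remark 2.2] -/
@[simp] theorem coe_leviScalar (u : ℂˣ) :
    ((leviScalar l u : SpecialLinearGroup (l ⊕ l) ℂ) : Matrix (l ⊕ l) (l ⊕ l) ℂ) =
      fromBlocks ((u : ℂ) • 1) 0 0 ((u : ℂ)⁻¹ • 1) :=
  rfl

/-- **The Siegel Levi subgroup `Sp_{2l}(ℂ) ∩ {diag(g, g')} = {diag(g, ᵗg⁻¹)} ≅ GL_l(ℂ)`** of `SL_{l ⊕ l}(ℂ)`: the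
symplectic matrices preserving both halves `V₁ = ℂ^l ⊕ 0`, `V₂ = 0 ⊕ ℂ^l` (equivalently, commuting with the weight
`diag(2·1, ½·1)`). [cite: Milne1999LefschetzClasses, §2 Remark 2.2 («`α ↦ α|V₁ : U(φ)_Ω → GL(V₁)` is an isomorphism»)] -/
def siegelLevi : Subgroup (SpecialLinearGroup (l ⊕ l) ℂ) :=
  symplecticGroupC l ⊓ Subgroup.centralizer {leviScalar l (Units.mk0 2 two_ne_zero)}

variable {l}

/-- Commuting with the weight `diag(2·1, ½·1)` means being block diagonal. [folklore] -/
private theorem weight_mul_eq_mul_weight_iff (A B C D : Matrix l l ℂ) :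
    fromBlocks ((2 : ℂ) • (1 : Matrix l l ℂ)) 0 0 ((2 : ℂ)⁻¹ • 1) * fromBlocks A B C D =
        fromBlocks A B C D * fromBlocks ((2 : ℂ) • (1 : Matrix l l ℂ)) 0 0 ((2 : ℂ)⁻¹ • 1) ↔
      B = 0 ∧ C = 0 := by
  rw [fromBlocks_multiply, fromBlocks_multiply]
  simp only [Matrix.mul_zero, Matrix.zero_mul, add_zero, zero_add, Matrix.smul_mul, Matrix.mul_smul,
    Matrix.one_mul, Matrix.mul_one, fromBlocks_inj]
  have h32 : (2 : ℂ) - 2⁻¹ ≠ 0 := by norm_num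
  constructor
  · rintro ⟨-, hB, hC, -⟩
    refine ⟨?_, ?_⟩
    · have h : ((2 : ℂ) - 2⁻¹) • B = 0 := by rw [sub_smul, hB, sub_self]
      exact (smul_eq_zero.1 h).resolve_left h32
    · have h : ((2 : ℂ) - 2⁻¹) • C = 0 := by rw [sub_smul, hC, sub_self]
      exact (smul_eq_zero.1 h).resolve_left h32
  · rintro ⟨rfl, rfl⟩
    simp only [smul_zero, and_self]

/-- Membership in the centraliser of the weight: the off-diagonal blocks vanish. [folklore] -/
private theorem mem_centralizer_weight_iff {N : SpecialLinearGroup (l ⊕ l) ℂ} {A B C D : Matrix l l ℂ}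
    (hN : (N : Matrix (l ⊕ l) (l ⊕ l) ℂ) = fromBlocks A B C D) :
    N ∈ Subgroup.centralizer {leviScalar l (Units.mk0 2 two_ne_zero)} ↔ B = 0 ∧ C = 0 := by
  rw [Subgroup.mem_centralizer_iff]
  simp only [Set.mem_singleton_iff, forall_eq]
  constructor
  · intro h
    have h' := congrArg (fun M : SpecialLinearGroup (l ⊕ l) ℂ ↦ (M : Matrix (l ⊕ l) (l ⊕ l) ℂ)) h
    simp only [SpecialLinearGroup.coe_mul, coe_leviScalar, Units.val_mk0, hN] at h'
    exact (weight_mul_eq_mul_weight_iff A B C D).1 h'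
  · intro h
    refine Subtype.ext ?_
    rw [SpecialLinearGroup.coe_mul, SpecialLinearGroup.coe_mul, coe_leviScalar, Units.val_mk0, hN]
    exact (weight_mul_eq_mul_weight_iff A B C D).2 h

/-- For a block-diagonal matrix the symplectic condition `ᵗN J N = J` reads `ᵗg g' = 1`. [cite: Milne1999LefschetzClasses, §2 Remark 2.2] -/
private theorem fromBlocks_diag_symplectic_iff (A D : Matrix l l ℂ) :
    (fromBlocks A 0 0 D)ᵀ * Matrix.J l ℂ * fromBlocks A 0 0 D = Matrix.J l ℂ ↔ Aᵀ * D = 1 := by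
  rw [Matrix.J, fromBlocks_transpose, fromBlocks_multiply, fromBlocks_multiply]
  simp only [Matrix.mul_zero, Matrix.zero_mul, add_zero, zero_add, Matrix.mul_one, Matrix.mul_neg, Matrix.neg_mul,
    transpose_zero, neg_zero, fromBlocks_inj, neg_inj, true_and, and_true]
  refine ⟨fun h ↦ h.1, fun h ↦ ⟨h, ?_⟩⟩
  rw [← transpose_transpose A, ← transpose_mul, h, transpose_one]

/-- **Membership in the Siegel Levi**: `N = diag(g, g')` with `ᵗg g' = 1`. [cite: Milne1999LefschetzClasses, §2 Remark 2.2] -/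
theorem mem_siegelLevi_iff {N : SpecialLinearGroup (l ⊕ l) ℂ} {A B C D : Matrix l l ℂ}
    (hN : (N : Matrix (l ⊕ l) (l ⊕ l) ℂ) = fromBlocks A B C D) :
    N ∈ siegelLevi l ↔ B = 0 ∧ C = 0 ∧ Aᵀ * D = 1 := by
  rw [siegelLevi, Subgroup.mem_inf, mem_centralizer_weight_iff hN, mem_symplecticGroupC_iff', hN]
  constructor
  · rintro ⟨h, rfl, rfl⟩
    exact ⟨rfl, rfl, (fromBlocks_diag_symplectic_iff A D).1 h⟩
  · rintro ⟨rfl, rfl, h⟩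
    exact ⟨(fromBlocks_diag_symplectic_iff A D).2 h, rfl, rfl⟩

/-- `leviScalar u ∈ siegelLevi`. [cite: Milne1999LefschetzClasses, §2 Remark 2.2] -/
theorem leviScalar_mem_siegelLevi (u : ℂˣ) : leviScalar l u ∈ siegelLevi l := by
  rw [mem_siegelLevi_iff (coe_leviScalar l u)]
  refine ⟨rfl, rfl, ?_⟩
  rw [transpose_smul, transpose_one, smul_mul_smul_comm, Matrix.one_mul, Units.mul_inv', one_smul]

variable (l) in
/-- **The embedding `GL`-Levi `SL_l(ℂ) →* SL_{2l}(ℂ)`, `g ↦ diag(g, ᵗg⁻¹)`** (the standard representation on `V₁`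
and its contragredient on `V₂`). [cite: Milne1999LefschetzClasses, §2 Remark 2.2 («standard representation … contragredient of the standard representation»)] -/
def siegelEmb : SpecialLinearGroup l ℂ →* SpecialLinearGroup (l ⊕ l) ℂ where
  toFun g := ⟨fromBlocks (g : Matrix l l ℂ) 0 0 ((g⁻¹ : SpecialLinearGroup l ℂ) : Matrix l l ℂ)ᵀ, by
    rw [det_fromBlocks_zero₂₁, det_transpose, g.2, (g⁻¹).2, mul_one]⟩
  map_one' := Subtype.ext (by
    change fromBlocks ((1 : SpecialLinearGroup l ℂ) : Matrix l l ℂ) 0 0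
      (((1 : SpecialLinearGroup l ℂ)⁻¹ : SpecialLinearGroup l ℂ) : Matrix l l ℂ)ᵀ = 1
    rw [inv_one, SpecialLinearGroup.coe_one, transpose_one, fromBlocks_one])
  map_mul' g h := Subtype.ext (by
    change fromBlocks ((g * h : SpecialLinearGroup l ℂ) : Matrix l l ℂ) 0 0
        (((g * h)⁻¹ : SpecialLinearGroup l ℂ) : Matrix l l ℂ)ᵀ =
      fromBlocks (g : Matrix l l ℂ) 0 0 ((g⁻¹ : SpecialLinearGroup l ℂ) : Matrix l l ℂ)ᵀ *
        fromBlocks (h : Matrix l l ℂ) 0 0 ((h⁻¹ : SpecialLinearGroup l ℂ) : Matrix l l ℂ)ᵀ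
    rw [fromBlocks_multiply, _root_.mul_inv_rev, SpecialLinearGroup.coe_mul, SpecialLinearGroup.coe_mul, transpose_mul]
    simp only [Matrix.mul_zero, Matrix.zero_mul, add_zero, zero_add])

/-- The matrix of `siegelEmb g`. [cite: Milne1999LefschetzClasses, §2 Remark 2.2] -/
@[simp] theorem coe_siegelEmb (g : SpecialLinearGroup l ℂ) :
    ((siegelEmb l g : SpecialLinearGroup (l ⊕ l) ℂ) : Matrix (l ⊕ l) (l ⊕ l) ℂ) =
      fromBlocks (g : Matrix l l ℂ) 0 0 ((g⁻¹ : SpecialLinearGroup l ℂ) : Matrix l l ℂ)ᵀ :=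
  rfl

/-- `g⁻¹ g = 1` on matrices. [folklore] -/
private theorem coe_inv_mul_coe (g : SpecialLinearGroup l ℂ) :
    ((g⁻¹ : SpecialLinearGroup l ℂ) : Matrix l l ℂ) * (g : Matrix l l ℂ) = 1 := by
  rw [← SpecialLinearGroup.coe_mul, inv_mul_cancel, SpecialLinearGroup.coe_one]

/-- `siegelEmb g ∈ siegelLevi`. [cite: Milne1999LefschetzClasses, §2 Remark 2.2] -/
theorem siegelEmb_mem_siegelLevi (g : SpecialLinearGroup l ℂ) : siegelEmb l g ∈ siegelLevi l := by
  rw [mem_siegelLevi_iff (coe_siegelEmb g)]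
  refine ⟨rfl, rfl, ?_⟩
  rw [← transpose_mul, coe_inv_mul_coe, transpose_one]

/-- **Levi decomposition of an element: `diag(g, ᵗg⁻¹) = siegelEmb(μ⁻¹ g) · leviScalar(μ)` with `μ^l = det g`.**
[cite: Milne1999LefschetzClasses, §2 Remark 2.2 («`U(φ)_Ω → GL(V₁)` is an isomorphism»)] [cite: Springer1998, Exercise 2.2.2 (1)] -/
theorem exists_eq_siegelEmb_mul_leviScalar {N : SpecialLinearGroup (l ⊕ l) ℂ} (hN : N ∈ siegelLevi l) :
    ∃ (s : SpecialLinearGroup l ℂ) (u : ℂˣ), N = siegelEmb l s * leviScalar l u := by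
  obtain ⟨A, B, C, D, hNeq⟩ : ∃ A B C D : Matrix l l ℂ, (N : Matrix (l ⊕ l) (l ⊕ l) ℂ) = fromBlocks A B C D :=
    ⟨_, _, _, _, (fromBlocks_toBlocks _).symm⟩
  obtain ⟨rfl, rfl, hAD⟩ := (mem_siegelLevi_iff hNeq).1 hN
  have hAu : IsUnit A.det := by
    rw [← det_transpose]
    exact Matrix.isUnit_det_of_right_inverse hAD
  rcases isEmpty_or_nonempty l with hl | hl
  · refine ⟨1, 1, Subtype.ext (Matrix.ext fun i ↦ ?_)⟩
    exact isEmptyElim i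
  obtain ⟨μ, hμ⟩ := IsAlgClosed.exists_pow_nat_eq A.det (Fintype.card_pos (α := l))
  have hμ0 : μ ≠ 0 := by
    rintro rfl
    rw [zero_pow (Fintype.card_pos (α := l)).ne'] at hμ
    exact hAu.ne_zero hμ.symm
  let s : SpecialLinearGroup l ℂ := ⟨μ⁻¹ • A, by rw [det_smul, inv_pow, hμ, inv_mul_cancel₀ hAu.ne_zero]⟩
  refine ⟨s, Units.mk0 μ hμ0, Subtype.ext ?_⟩
  rw [hNeq, SpecialLinearGroup.coe_mul, coe_siegelEmb, coe_leviScalar, Units.val_mk0, fromBlocks_multiply]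
  simp only [Matrix.mul_zero, add_zero, zero_add, Matrix.mul_smul, Matrix.mul_one, smul_zero]
  -- the second block: both `ᵗD` and `μ⁻¹ s⁻¹` are left inverses of `A`
  have hs : ((s⁻¹ : SpecialLinearGroup l ℂ) : Matrix l l ℂ) * (μ⁻¹ • A) = 1 := coe_inv_mul_coe s
  have hD : Dᵀ * A = 1 := by
    rw [← transpose_transpose A, ← transpose_mul, hAD, transpose_one]
  have h1 : μ⁻¹ • ((s⁻¹ : SpecialLinearGroup l ℂ) : Matrix l l ℂ) = Dᵀ := by
    rw [Matrix.mul_smul, ← Matrix.smul_mul] at hs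
    rw [← Matrix.inv_eq_left_inv hs, Matrix.inv_eq_left_inv hD]
  refine fromBlocks_inj.2 ⟨?_, rfl, rfl, ?_⟩
  · change A = μ • (μ⁻¹ • A)
    rw [smul_smul, mul_inv_cancel₀ hμ0, one_smul]
  · rw [← transpose_smul, h1, transpose_transpose]

end Levi

/-! ## §2 Generation by Laurent generators: the Siegel Levi is connected -/

section Generation

variable {l : Type*} [Fintype l] [DecidableEq l]

omit [Fintype l] [DecidableEq l] in
/-- `fromBlocks` is linear in the diagonal blocks: Laurent curves of blocks give Laurent curves. [folklore] -/
private theorem fromBlocks_laurent (a₀ a₁ a₂ b₀ b₁ b₂ : Matrix l l ℂ) (u : ℂ) :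
    fromBlocks (a₀ + u • a₁ + u⁻¹ • a₂) 0 0 (b₀ + u • b₁ + u⁻¹ • b₂) =
      fromBlocks a₀ 0 0 b₀ + u • fromBlocks a₁ 0 0 b₁ + u⁻¹ • fromBlocks a₂ (0 : Matrix l l ℂ) 0 b₂ := by
  rw [fromBlocks_smul, fromBlocks_smul, fromBlocks_add, fromBlocks_add, smul_zero, smul_zero, add_zero, add_zero]

/-- `u − u⁻¹` takes every value on `ℂ^×`. [folklore] -/
private theorem exists_sub_inv_eq' (c : ℂ) : ∃ u : ℂ, u ≠ 0 ∧ u - u⁻¹ = c := by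
  obtain ⟨s, hs⟩ := IsAlgClosed.exists_pow_nat_eq (c ^ 2 + 4) (by norm_num : 0 < 2)
  set u : ℂ := (c + s) / 2 with hu_def
  have hu : u ≠ 0 := by
    intro h
    have hcs : s = -c := by linear_combination 2 * h
    rw [hcs] at hs
    have : (4 : ℂ) = 0 := by linear_combination -hs
    norm_num at this
  have hu2 : u ^ 2 - c * u - 1 = 0 := by
    rw [hu_def]
    linear_combination hs / 4
  refine ⟨u, hu, sub_eq_zero.1 ((mul_eq_zero.1 ?_).resolve_left hu)⟩
  rw [mul_sub, mul_sub, mul_inv_cancel₀ hu]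
  linear_combination hu2

/-- The matrix of `siegelEmb (U_{ij}(c)) = diag(1 + cE_{ij}, 1 − cE_{ji}) = 1 + c·T_{ij}`. [cite: Milne1999LefschetzClasses, §2 Remark 2.2] -/
theorem coe_siegelEmb_transvectionSL {i j : l} (hij : i ≠ j) (c : ℂ) :
    ((siegelEmb l (transvectionSL i j hij c) : SpecialLinearGroup (l ⊕ l) ℂ) : Matrix (l ⊕ l) (l ⊕ l) ℂ) =
      1 + c • fromBlocks (Matrix.single i j (1 : ℂ)) 0 0 (-Matrix.single j i 1) := by
  rw [coe_siegelEmb, transvectionSL_inv, coe_transvectionSL, coe_transvectionSL, Matrix.transvection,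
    Matrix.transvection, transpose_add, transpose_one, transpose_single, ← fromBlocks_one, fromBlocks_smul,
    fromBlocks_add, smul_zero, add_zero, smul_neg, Matrix.smul_single, Matrix.smul_single, smul_eq_mul, mul_one,
    single_neg]

/-- **`siegelEmb(U_{ij}(ℂ))` is a Laurent generator**: the image of `u ↦ 1 + (u − u⁻¹)T_{ij} = 1 + uT_{ij} + u⁻¹(−T_{ij})`.
[cite: MalleTesterman2011, Prop. 1.16 and Example 1.17 (1)] [cite: Milne1999LefschetzClasses, §2 Remark 2.2] -/
theorem isLaurentGenerator_image_siegelEmb_rootGroup (i j : l) (hij : i ≠ j) :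
    IsLaurentGenerator (siegelEmb l '' rootGroup i j hij) where
  one_mem := ⟨transvectionSL i j hij 0, ⟨0, rfl⟩, by rw [transvectionSL_zero, map_one]⟩
  inv_mem := by
    rintro _ ⟨_, ⟨c, rfl⟩, rfl⟩
    exact ⟨transvectionSL i j hij (-c), ⟨-c, rfl⟩, by rw [← map_inv, transvectionSL_inv]⟩
  exists_laurent := by
    refine ⟨1, fromBlocks (Matrix.single i j (1 : ℂ)) 0 0 (-Matrix.single j i 1),
      -fromBlocks (Matrix.single i j (1 : ℂ)) 0 0 (-Matrix.single j i 1), ?_, fun u hu ↦ ?_⟩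
    · rintro _ ⟨_, ⟨c, rfl⟩, rfl⟩
      obtain ⟨u, hu, huc⟩ := exists_sub_inv_eq' c
      refine ⟨u, hu, ?_⟩
      rw [coe_siegelEmb_transvectionSL, ← huc, sub_smul, smul_neg, sub_eq_add_neg, add_assoc]
    · refine ⟨siegelEmb l (transvectionSL i j hij (u - u⁻¹)), ⟨_, ⟨u - u⁻¹, rfl⟩, rfl⟩, ?_⟩
      rw [coe_siegelEmb_transvectionSL, sub_smul, smul_neg, sub_eq_add_neg, add_assoc]

/-- The matrix of `siegelEmb (T_{i₀ i}(u)) = diag(torusVec u, torusVec u⁻¹)`. [cite: Milne1999LefschetzClasses, §2 Remark 2.2] -/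
theorem coe_siegelEmb_rankOneTorusHom {i₀ i : l} (h : i ≠ i₀) (u : ℂˣ) :
    ((siegelEmb l (rankOneTorusHom i₀ i h u) : SpecialLinearGroup (l ⊕ l) ℂ) : Matrix (l ⊕ l) (l ⊕ l) ℂ) =
      fromBlocks (diagonal (torusVec i₀ i u)) 0 0 (diagonal (torusVec i₀ i (u : ℂ)⁻¹)) := by
  rw [coe_siegelEmb, ← map_inv, coe_rankOneTorusHom, coe_rankOneTorusHom, diagonal_transpose, Units.val_inv_eq_inv_val]

omit [Fintype l] in
/-- The Laurent form of the torus vector: `torusVec u = a + u e_i + u⁻¹ e_{i₀}`. [cite: Springer1998, Exercise 2.2.2 (1)] -/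
private theorem torusVec_eq_laurent' {i₀ i : l} (h : i ≠ i₀) (u : ℂ) :
    torusVec i₀ i u = torusVec i₀ i 0 * torusVec i₀ i 0 + u • Pi.single i 1 + u⁻¹ • Pi.single i₀ 1 := by
  funext j
  simp only [Pi.add_apply, Pi.mul_apply, Pi.smul_apply, smul_eq_mul]
  rcases eq_or_ne j i₀ with rfl | hj₀
  · rw [torusVec_apply_base, torusVec_apply_base, Pi.single_eq_of_ne' h, Pi.single_eq_same]
    simp
  rcases eq_or_ne j i with rfl | hj
  · rw [torusVec_apply_self h, torusVec_apply_self h, Pi.single_eq_same, Pi.single_eq_of_ne hj₀]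
    simp
  · rw [torusVec_apply_of_ne hj₀ hj, torusVec_apply_of_ne hj₀ hj, Pi.single_eq_of_ne hj, Pi.single_eq_of_ne hj₀]
    simp

omit [Fintype l] in
/-- The Laurent form of the inverse torus vector: `torusVec u⁻¹ = a + u e_{i₀} + u⁻¹ e_i`. [cite: Springer1998, Exercise 2.2.2 (1)] -/
private theorem torusVec_inv_eq_laurent {i₀ i : l} (h : i ≠ i₀) (u : ℂ) :
    torusVec i₀ i u⁻¹ = torusVec i₀ i 0 * torusVec i₀ i 0 + u • Pi.single i₀ 1 + u⁻¹ • Pi.single i 1 := by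
  rw [torusVec_eq_laurent' h, inv_inv]
  abel

omit [Fintype l] in
/-- `diag` is linear: Laurent curves of vectors give Laurent curves of matrices. [folklore] -/
private theorem diagonal_laurent' (a b c : l → ℂ) (u : ℂ) :
    diagonal (a + u • b + u⁻¹ • c) = diagonal a + u • diagonal b + u⁻¹ • diagonal c := by
  ext j k
  simp only [diagonal_apply, Matrix.add_apply, Matrix.smul_apply, Pi.add_apply, Pi.smul_apply, smul_eq_mul]
  split_ifs <;> ring

/-- **`siegelEmb(T_{i₀ i}(ℂ^×))` is a Laurent generator**: the image of
`u ↦ diag(a, a) + u·diag(E_{ii}, E_{i₀i₀}) + u⁻¹·diag(E_{i₀i₀}, E_{ii})`. [cite: MalleTesterman2011, Prop. 1.16 and Example 1.17 (1)]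
[cite: Springer1998, Exercise 2.2.2 (1)] -/
theorem isLaurentGenerator_image_siegelEmb_rankOneTorus (i₀ i : l) (h : i ≠ i₀) :
    IsLaurentGenerator (siegelEmb l '' rankOneTorus i₀ i h) where
  one_mem := ⟨1, ⟨1, map_one _⟩, map_one _⟩
  inv_mem := by
    rintro _ ⟨_, ⟨u, rfl⟩, rfl⟩
    exact ⟨rankOneTorusHom i₀ i h u⁻¹, ⟨u⁻¹, rfl⟩, by rw [map_inv, map_inv]⟩
  exists_laurent := by
    refine ⟨fromBlocks (diagonal (torusVec i₀ i 0 * torusVec i₀ i 0)) 0 0 (diagonal (torusVec i₀ i 0 * torusVec i₀ i 0)),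
      fromBlocks (diagonal (Pi.single i 1)) 0 0 (diagonal (Pi.single i₀ 1)),
      fromBlocks (diagonal (Pi.single i₀ 1)) 0 0 (diagonal (Pi.single i 1)), ?_, fun u hu ↦ ?_⟩
    · rintro _ ⟨_, ⟨u, rfl⟩, rfl⟩
      refine ⟨u, u.ne_zero, ?_⟩
      rw [coe_siegelEmb_rankOneTorusHom, torusVec_eq_laurent' h, torusVec_inv_eq_laurent h, diagonal_laurent',
        diagonal_laurent', fromBlocks_laurent]
    · refine ⟨siegelEmb l (rankOneTorusHom i₀ i h (Units.mk0 u hu)), ⟨_, ⟨_, rfl⟩, rfl⟩, ?_⟩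
      rw [coe_siegelEmb_rankOneTorusHom, Units.val_mk0, torusVec_eq_laurent' h, torusVec_inv_eq_laurent h,
        diagonal_laurent', diagonal_laurent', fromBlocks_laurent]

variable (l) in
/-- The generating family of the Siegel Levi: the images `siegelEmb(U_{ij})`, `siegelEmb(T_{ij})` of the generators of
`SL_l(ℂ)` and the central torus `leviScalar(ℂ^×)`. [cite: Milne1999LefschetzClasses, §2 Remark 2.2] [cite: MalleTesterman2011, Example 1.17 (1)] -/
def leviGenerators : ({p : l × l // p.1 ≠ p.2} ⊕ {p : l × l // p.1 ≠ p.2}) ⊕ Unit →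
    Set (SpecialLinearGroup (l ⊕ l) ℂ)
  | Sum.inl a => siegelEmb l '' slGenerators a
  | Sum.inr _ => Set.range (leviScalar l)

/-- **The central torus `leviScalar(ℂ^×)` is a Laurent generator**: `u ↦ u·diag(1, 0) + u⁻¹·diag(0, 1)`.
[cite: Springer1998, Exercise 2.2.2 (1) («`G_m`»)] -/
theorem isLaurentGenerator_range_leviScalar : IsLaurentGenerator (Set.range (leviScalar l)) where
  one_mem := ⟨1, map_one _⟩
  inv_mem := by
    rintro _ ⟨u, rfl⟩
    exact ⟨u⁻¹, map_inv _ _⟩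
  exists_laurent := by
    refine ⟨0, fromBlocks 1 0 0 0, fromBlocks 0 0 0 1, ?_, fun u hu ↦ ⟨leviScalar l (Units.mk0 u hu), ⟨_, rfl⟩, ?_⟩⟩
    · rintro _ ⟨u, rfl⟩
      refine ⟨u, u.ne_zero, ?_⟩
      simp only [coe_leviScalar, zero_add, fromBlocks_smul, fromBlocks_add, smul_zero, add_zero]
    · simp only [coe_leviScalar, Units.val_mk0, zero_add, fromBlocks_smul, fromBlocks_add, smul_zero, add_zero]

/-- Every member of the generating family is a Laurent generator. [cite: MalleTesterman2011, Prop. 1.16 and Example 1.17 (1)] -/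
theorem isLaurentGenerator_leviGenerators (a : ({p : l × l // p.1 ≠ p.2} ⊕ {p : l × l // p.1 ≠ p.2}) ⊕ Unit) :
    IsLaurentGenerator (leviGenerators l a) := by
  rcases a with (p | p) | _
  · exact isLaurentGenerator_image_siegelEmb_rootGroup p.1.1 p.1.2 p.2
  · exact isLaurentGenerator_image_siegelEmb_rankOneTorus p.1.1 p.1.2 (Ne.symm p.2)
  · exact isLaurentGenerator_range_leviScalar

/-- **The Siegel Levi is generated by its Laurent generators** (`GL_l = ℂ^× · SL_l`, `SL_l = ⟨U_{ij}, T_{ij}⟩`).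
[cite: Milne1999LefschetzClasses, §2 Remark 2.2] [cite: MalleTesterman2011, Example 1.17 (1)] [cite: Springer1998, Exercise 2.2.2 (1)] -/
theorem closure_iUnion_leviGenerators : Subgroup.closure (⋃ a, leviGenerators l a) = siegelLevi l := by
  apply le_antisymm
  · rw [Subgroup.closure_le]
    intro M hM
    obtain ⟨a, ha⟩ := Set.mem_iUnion.1 hM
    rcases a with a | a
    · obtain ⟨g, -, rfl⟩ := ha
      exact siegelEmb_mem_siegelLevi g
    · obtain ⟨u, rfl⟩ := ha
      exact leviScalar_mem_siegelLevi u
  · intro N hN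
    obtain ⟨s, u, rfl⟩ := exists_eq_siegelEmb_mul_leviScalar hN
    refine mul_mem ?_ (Subgroup.subset_closure (Set.mem_iUnion.2 ⟨Sum.inr (), u, rfl⟩))
    have hs : s ∈ Subgroup.closure (⋃ a, slGenerators (ι := l) a) := by
      rw [closure_iUnion_slGenerators_eq_top]
      exact Subgroup.mem_top s
    have h := Subgroup.mem_map_of_mem (siegelEmb l) hs
    rw [MonoidHom.map_closure, Set.image_iUnion] at h
    exact Subgroup.closure_mono (Set.iUnion_subset fun a ↦ Set.subset_iUnion_of_subset (Sum.inl a) Set.Subset.rfl) h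

/-- **The Siegel Levi is Zariski-closed** (symplectic equations and a centraliser). [cite: Springer1998, Prop. 2.2.1] -/
theorem isZariskiClosed_siegelLevi : IsZariskiClosed (siegelLevi l) :=
  (isZariskiClosed_symplecticGroupC l).inf (isZariskiClosed_centralizer _)

/-- **The Siegel Levi `{diag(g, ᵗg⁻¹)} ≅ GL_l(ℂ)` is connected: its vanishing ideal is prime** (Milne's table, type
IV: «GL … Connected: Yes»; Springer: «`GL_n` … connected»). [cite: Milne1999LefschetzClasses, §2 Remark 2.2 and Summary table (p. 652)]
[cite: Springer1998, Exercise 2.2.2 (1) and Cor. 2.2.7 (i)] [cite: MalleTesterman2011, Prop. 1.16] -/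
theorem isPrime_vanishingIdealC_siegelLevi : (vanishingIdealC (siegelLevi l)).IsPrime := by
  rw [← closure_iUnion_leviGenerators]
  exact isPrime_vanishingIdealC_closure_iUnion _ isLaurentGenerator_leviGenerators

end Generation

/-! ## §3 Milne's Remark 2.2: the unitary group of a split skew-Hermitian pair is a conjugate of the Siegel Levi -/

section UnitaryPair

variable {l : Type*} [Fintype l] [DecidableEq l]

omit [Fintype l] [DecidableEq l] in
/-- An alternating form on `V₁ ⊕ V₂` vanishing on `V₁ × V₁` and on `V₂ × V₂` is `(0 A; −ᵗA 0)`: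
«`φ((x₁, x₂), (y₁, y₂)) = (φ₁(x₁, y₂), −φ₁(x₂, y₁))`». [cite: Milne1999LefschetzClasses, §2 Remark 2.2] -/
theorem eq_fromBlocks_toBlocks₁₂_of_transpose_eq_neg {H : Matrix (l ⊕ l) (l ⊕ l) ℂ} (hHt : Hᵀ = -H)
    (h₁₁ : ∀ i j, H (Sum.inl i) (Sum.inl j) = 0) (h₂₂ : ∀ i j, H (Sum.inr i) (Sum.inr j) = 0) :
    H = fromBlocks 0 H.toBlocks₁₂ (-(H.toBlocks₁₂)ᵀ) 0 := by
  ext (i | i) (j | j)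
  · rw [fromBlocks_apply₁₁, Matrix.zero_apply, h₁₁]
  · rw [fromBlocks_apply₁₂]
    rfl
  · have h := congrFun (congrFun hHt (Sum.inl j)) (Sum.inr i)
    rw [transpose_apply, Matrix.neg_apply] at h
    rw [fromBlocks_apply₂₁, Matrix.neg_apply, transpose_apply, h]
    rfl
  · rw [fromBlocks_apply₂₂, Matrix.zero_apply, h₂₂]

/-- The symplectic basis adapted to the splitting: `ᵗQ (0 A; −ᵗA 0) Q = J` for `Q = diag(1, −A⁻¹)`.
[cite: Milne1999LefschetzClasses, §2 Remark 2.2] [cite: McDuffSalamon2017, Thm. 2.1.3 (change of symplectic basis)] -/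
theorem transpose_mul_fromBlocks_mul_eq_J {A : Matrix l l ℂ} (hA : IsUnit A.det) :
    (fromBlocks 1 0 0 (-A⁻¹))ᵀ * fromBlocks 0 A (-Aᵀ) 0 * fromBlocks 1 0 0 (-A⁻¹) = Matrix.J l ℂ := by
  have hAtA : (A⁻¹)ᵀ * Aᵀ = 1 := by rw [← transpose_mul, mul_nonsing_inv _ hA, transpose_one]
  rw [Matrix.J, fromBlocks_transpose, fromBlocks_multiply, fromBlocks_multiply]
  simp only [Matrix.mul_zero, Matrix.zero_mul, zero_add, add_zero, Matrix.one_mul, Matrix.mul_one, transpose_zero,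
    transpose_one, transpose_neg, Matrix.neg_mul, Matrix.mul_neg, neg_neg, neg_zero, hAtA, mul_nonsing_inv _ hA]

/-- **Milne's Remark 2.2 — the unitary group of a split skew-Hermitian space is `GL(V₁)` — in coordinates.** Let `H`
be an alternating invertible matrix on `V₁ ⊕ V₂ = ℂ^l ⊕ ℂ^l` with `H|V₁ × V₁ = 0 = H|V₂ × V₂` («there is a
nondegenerate `Ω`-bilinear form `φ₁ : V₁ × V₂ → Ω` such that `φ((x₁, x₂), (y₁, y₂)) = (φ₁(x₁, y₂), −φ₁(x₂, y₁))`»). Then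
the group of `N ∈ SL_{2l}(ℂ)` with `ᵗN H N = H` preserving `V₁` and `V₂` («`α ↦ α|V₁ : U(φ)_Ω → GL(V₁)` is an
isomorphism») is the `GL_{2l}(ℂ)`-conjugate `Q · siegelLevi · Q⁻¹`, `Q = diag(1, −A⁻¹)`, of the Siegel Levi
`{diag(g, ᵗg⁻¹)} ≅ GL_l(ℂ)`; in particular it is Zariski-closed with prime vanishing ideal («GL … Connected: Yes»).
[cite: Milne1999LefschetzClasses, §2 Remark 2.2 (p. 647–648) and Summary table (p. 652)] [cite: Springer1998, Exercise 2.2.2 (1), Prop. 2.2.1] -/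
theorem exists_subgroup_unitaryPair {H : Matrix (l ⊕ l) (l ⊕ l) ℂ} (hHt : Hᵀ = -H) (hHu : IsUnit H.det)
    (h₁₁ : ∀ i j, H (Sum.inl i) (Sum.inl j) = 0) (h₂₂ : ∀ i j, H (Sum.inr i) (Sum.inr j) = 0) :
    ∃ K : Subgroup (SpecialLinearGroup (l ⊕ l) ℂ), IsZariskiClosed K ∧ (vanishingIdealC K).IsPrime ∧
      ∀ N : SpecialLinearGroup (l ⊕ l) ℂ, N ∈ K ↔
        (N : Matrix (l ⊕ l) (l ⊕ l) ℂ)ᵀ * H * N = H ∧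
          (∀ i j, (N : Matrix (l ⊕ l) (l ⊕ l) ℂ) (Sum.inl i) (Sum.inr j) = 0) ∧
            ∀ i j, (N : Matrix (l ⊕ l) (l ⊕ l) ℂ) (Sum.inr i) (Sum.inl j) = 0 := by
  -- `H = (0 A; -ᵗA 0)` with `A` invertible
  set A : Matrix l l ℂ := H.toBlocks₁₂ with hA_def
  have hHeq : H = fromBlocks 0 A (-Aᵀ) 0 := eq_fromBlocks_toBlocks₁₂_of_transpose_eq_neg hHt h₁₁ h₂₂
  obtain ⟨X, Y, W, Z, hi⟩ : ∃ X Y W Z : Matrix l l ℂ, H⁻¹ = fromBlocks X Y W Z :=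
    ⟨_, _, _, _, (fromBlocks_toBlocks _).symm⟩
  have hAW : A * W = 1 := by
    have h := mul_nonsing_inv H hHu
    rw [hi, hHeq, fromBlocks_multiply, ← fromBlocks_one] at h
    have h1 := (fromBlocks_inj.1 h).1
    rwa [Matrix.zero_mul, zero_add] at h1
  have hAu : IsUnit A.det := Matrix.isUnit_det_of_right_inverse hAW
  -- the adapted symplectic basis `Q = diag(1, -A⁻¹)`
  set Q : Matrix (l ⊕ l) (l ⊕ l) ℂ := fromBlocks 1 0 0 (-A⁻¹) with hQ_def
  have hQQ' : Q * fromBlocks 1 0 0 (-A) = 1 := by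
    rw [hQ_def, fromBlocks_multiply, ← fromBlocks_one]
    simp only [Matrix.mul_zero, Matrix.zero_mul, add_zero, zero_add, Matrix.one_mul, neg_mul_neg,
      nonsing_inv_mul _ hAu]
  have hQ : IsUnit Q.det := Matrix.isUnit_det_of_right_inverse hQQ'
  have hQinv : Q⁻¹ = fromBlocks 1 0 0 (-A) := Matrix.inv_eq_right_inv hQQ'
  have hQHQ : Qᵀ * H * Q = Matrix.J l ℂ := by
    rw [hHeq, hQ_def]
    exact transpose_mul_fromBlocks_mul_eq_J hAu
  refine ⟨(siegelLevi l).map (conjGLC Q hQ).toMonoidHom, isZariskiClosed_siegelLevi.map_conjGLC hQ,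
    isPrime_vanishingIdealC_map_conjGLC hQ isPrime_vanishingIdealC_siegelLevi, fun N ↦ ?_⟩
  -- membership: `Q⁻¹ N Q ∈ Sp_J ⟺ ᵗN H N = H`, and `Q⁻¹ N Q` is block diagonal iff `N` is
  obtain ⟨N₁₁, N₁₂, N₂₁, N₂₂, hN⟩ : ∃ N₁₁ N₁₂ N₂₁ N₂₂ : Matrix l l ℂ,
      (N : Matrix (l ⊕ l) (l ⊕ l) ℂ) = fromBlocks N₁₁ N₁₂ N₂₁ N₂₂ := ⟨_, _, _, _, (fromBlocks_toBlocks _).symm⟩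
  have hconj : (((conjGLC Q hQ).symm N : SpecialLinearGroup (l ⊕ l) ℂ) : Matrix (l ⊕ l) (l ⊕ l) ℂ) =
      fromBlocks N₁₁ (-(N₁₂ * A⁻¹)) (-(A * N₂₁)) (A * N₂₂ * A⁻¹) := by
    rw [coe_conjGLC_symm, hQinv, hN, hQ_def, fromBlocks_multiply, fromBlocks_multiply]
    simp only [Matrix.mul_zero, Matrix.zero_mul, add_zero, zero_add, Matrix.one_mul, Matrix.mul_one, Matrix.neg_mul,
      Matrix.mul_neg, neg_neg]
  rw [Subgroup.mem_map_equiv, siegelLevi, Subgroup.mem_inf, mem_symplecticGroupC_iff', coe_conjGLC_symm,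
    ← transpose_mul_mul_eq_iff_conj hQ hQHQ, mem_centralizer_weight_iff hconj]
  refine and_congr Iff.rfl (and_congr ?_ ?_)
  · rw [neg_eq_zero]
    constructor
    · intro h i j
      have h0 : N₁₂ = 0 := by rw [← Matrix.nonsing_inv_mul_cancel_right A N₁₂ hAu, h, Matrix.zero_mul]
      rw [hN, fromBlocks_apply₁₂, h0, Matrix.zero_apply]
    · intro h
      have h0 : N₁₂ = 0 :=
        Matrix.ext fun i j ↦ by rw [← fromBlocks_apply₁₂ N₁₁ N₁₂ N₂₁ N₂₂ i j, ← hN, h, Matrix.zero_apply]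
      rw [h0, Matrix.zero_mul]
  · rw [neg_eq_zero]
    constructor
    · intro h i j
      have h0 : N₂₁ = 0 := by rw [← Matrix.nonsing_inv_mul_cancel_left A N₂₁ hAu, h, Matrix.mul_zero]
      rw [hN, fromBlocks_apply₂₁, h0, Matrix.zero_apply]
    · intro h
      have h0 : N₂₁ = 0 :=
        Matrix.ext fun i j ↦ by rw [← fromBlocks_apply₂₁ N₁₁ N₁₂ N₂₁ N₂₂ i j, ← hN, h, Matrix.zero_apply]
      rw [h0, Matrix.mul_zero]

end UnitaryPair


end ComplexTorus

end Literature.Geometry.Kaehler
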